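import Literature.MathematicalPhysics.QuantumManyBody.BoseGasFreeDirichletBEC
import Literature.MathematicalPhysics.QuantumManyBody.PeriodicBoseGas
import Mathlib.MeasureTheory.Measure.WithDensity

/-!
# Crux `BoundaryTransferWeak` (stmt-AtomisticToContinuum-0827, routes `BECInsertionCorrector` /
# `BECPeriodicReduction`), line `Sketch` (coupled-bath relocation): stub `stub_freeTorusSlices`

Free torus slice typicality (S3 of the line, the `v = 0` class): for a periodic `C¹` state `Φ` of
`n + 1` bosons on the torus of side `L` with tiny kinetic energy `periodicEnergy 0 Φ ≤ δ`, the
one-body slices `y ↦ Φ(y, Ŵ)` are nearly constant for all but `η` (in `P = |Φ|² 1_{cell^{n+1}} dW`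
probability) of the baths `Ŵ = tail W`: there are a level `μ > 0` and a Chebyshev set `B` of
volume `≤ ε L³` and slice mass `≤ ε μ² L³` off which `μ/2 ≤ |Φ(y, Ŵ)| ≤ 3μ/2` on the cell.

Proof (elementary): with `m(Ŵ) = ∫_cell |Φ(·, Ŵ)|²`, `k(Ŵ) = ∫_cell |∇₀Φ(·, Ŵ)|²` one has
`∫_{cellⁿ} k ≤ ∫_{cell^{n+1}} |∇₀Φ|² ≤ periodicEnergy 0 Φ ≤ δ = t η` (one-bath disintegration),
so the bad baths `{t m < k} ∪ {m = 0}` carry `P`-mass `≤ δ/t = η` (Markov); on a good bath the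
cell Poincaré inequality `(π/L)² ∫_cell |f - ⟨f⟩|² ≤ ∫_cell |∇f|²` (`local_poincare_cellShift` with
the variance identity `lintegral_nnnorm_sq_cell_eq`) with `t = c (π/L)²`, `c = min ½ (ε/20)`, gives
`∫_cell |f - ⟨f⟩|² ≤ c m ≤ 2c L³ μ²`, `μ = |⟨f⟩| > 0`, and Chebyshev at level `μ/2` finishes.
[folklore]
-/

noncomputable section

namespace Summit.AtomisticToContinuum.BoseEinsteinCondensation.CoupledBaths

open Literature.MathematicalPhysics.QuantumManyBody.BoseGas MeasureTheory
open scoped ENNReal NNReal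

section Helpers

variable {n : ℕ} {L : ℝ}

/-- `Y ↦ ∫_Q G(x :: Y) dx` is measurable for measurable `G ≥ 0` (Tonelli). [folklore] -/
private theorem measurable_setLIntegral_vecCons_slice {G : Config (n + 1) → ℝ≥0∞}
    (hG : Measurable G) (Q : Set Space) :
    Measurable fun Y : Config n => ∫⁻ x in Q, G (Matrix.vecCons x Y) :=
  -- adapted from …Theorems/BECInsertionCorrectorBoundaryTransferWeakTorusTypicalityBath.lean
  (hG.comp (measurable_vecCons.comp measurable_swap)).lintegral_prod_right'

/-- **One-bath disintegration on the cell** (Tonelli in `W = (x, Y)` and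
`(x :: Y) ∈ cell^{n+1} ↔ x ∈ cell ∧ Y ∈ cellⁿ`):
`∫_{cell^{n+1}} F = ∫_{cellⁿ} dY ∫_cell F(x :: Y) dx` for measurable `F ≥ 0`. [folklore] -/
private theorem setLIntegral_cellN_succ {F : Config (n + 1) → ℝ≥0∞} (hF : Measurable F) :
    ∫⁻ W in cellN (n + 1) L, F W =
      ∫⁻ Y in cellN n L, ∫⁻ x in cell L, F (Matrix.vecCons x Y) := by
  rw [← lintegral_indicator (measurableSet_cellN (n + 1) L),
    lintegral_config_succ (hF.indicator (measurableSet_cellN (n + 1) L)),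
    ← lintegral_indicator (measurableSet_cellN n L)]
  refine lintegral_congr fun Y => ?_
  by_cases hY : Y ∈ cellN n L
  · rw [Set.indicator_of_mem hY, ← lintegral_indicator (measurableSet_cell L)]
    refine lintegral_congr fun x => ?_
    by_cases hx : x ∈ cell L
    · have hxY : Matrix.vecCons x Y ∈ cellN (n + 1) L := fun j =>
        Fin.cases (by simpa using hx) (fun k => by simpa using hY k) j
      rw [Set.indicator_of_mem hxY, Set.indicator_of_mem hx]
    · have hxY : Matrix.vecCons x Y ∉ cellN (n + 1) L := fun h => hx (by simpa using h 0)
      rw [Set.indicator_of_notMem hxY, Set.indicator_of_notMem hx]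
  · rw [Set.indicator_of_notMem hY]
    refine (lintegral_congr fun x => ?_).trans lintegral_zero
    exact Set.indicator_of_notMem (fun h => hY fun k => by simpa using h (Fin.succ k)) _

/-- `|∇₀Ψ|² ≤ |∇Ψ|² + (interaction) |Ψ|²` pointwise: one summand of the kinetic density.
[folklore] -/
private theorem partialGradSq_zero_le (Ψ : Config (n + 1) → ℂ) (U : Config (n + 1) → ℝ≥0∞)
    (X : Config (n + 1)) :
    partialGradSq 0 Ψ X ≤ kineticDensity Ψ X + U X * (‖Ψ X‖₊ : ℝ≥0∞) ^ 2 := by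
  refine le_add_right ?_
  rw [kineticDensity_eq_sum_partialGradSq]
  exact Finset.single_le_sum (f := fun i => partialGradSq i Ψ X) (fun i _ => zero_le)
    (Finset.mem_univ 0)

/-- **Slice typicality from a Poincaré budget** (deterministic core of the stub): if a `C¹` slice
`f` on the cell of side `L` has `∫_cell |∇f|² ≤ c (π/L)² ∫_cell |f|²`, `c = min ½ (ε/20)`, and
`∫_cell |f|² ≠ 0`, then with `μ = |L⁻³ ∫_cell f| > 0` and the Chebyshev set
`B = {y ∈ cell | μ/2 < |f y - L⁻³∫_cell f|}`: `|B| ≤ ε L³`, `∫_B |f|² ≤ ε μ² L³` and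
`μ/2 ≤ |f| ≤ 3μ/2` on `cell \ B`. [folklore] -/
private theorem slice_typical (hL : 0 < L) {ε : ℝ} (hε : 0 < ε) {f : Space → ℂ}
    (hf : ContDiff ℝ 1 f) (hm0 : ∫⁻ y in cell L, (‖f y‖₊ : ℝ≥0∞) ^ 2 ≠ 0)
    (hk : ∫⁻ y in cell L, gradSqC f y ≤
      ENNReal.ofReal (min (1 / 2) (ε / 20) * (Real.pi / L) ^ 2) *
        ∫⁻ y in cell L, (‖f y‖₊ : ℝ≥0∞) ^ 2) :
    ∃ μ : ℝ, 0 < μ ∧ ∃ B : Set Space, MeasurableSet B ∧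
      volume B ≤ ENNReal.ofReal (ε * L ^ 3) ∧
      ∫⁻ y in B, (‖f y‖₊ : ℝ≥0∞) ^ 2 ≤ ENNReal.ofReal (ε * μ ^ 2 * L ^ 3) ∧
      ∀ y ∈ cell L \ B, μ / 2 ≤ ‖f y‖ ∧ ‖f y‖ ≤ 3 * μ / 2 := by
  have hL3 : 0 < L ^ 3 := by positivity
  have hcontf : Continuous f := hf.continuous
  -- the Poincaré inequality on the cell and the variance identity, before naming things
  have hP := local_poincare_cellShift hL hf 0
  have hcs : cellShift L 0 = cell L := Set.ext fun x => by simp [cellShift]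
  rw [hcs] at hP
  have hpy := Literature.Barriers.AtomisticToContinuum.BoseGas.lintegral_nnnorm_sq_cell_eq hL hcontf
  have hV : volume.real (cell L) = L ^ 3 := by
    rw [measureReal_def, volume_cell, ← ENNReal.ofReal_pow hL.le, ENNReal.toReal_ofReal hL3.le]
  rw [setAverage_eq, hV] at hpy
  -- names
  set c : ℝ := min (1 / 2) (ε / 20) with hc
  have hc0 : 0 < c := lt_min (by norm_num) (by positivity)
  have hc2 : c ≤ 1 / 2 := min_le_left _ _
  have hcε : c ≤ ε / 20 := min_le_right _ _
  set K : ℝ := (Real.pi / L) ^ 2 with hK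
  have hK0 : 0 < K := by positivity
  set I : ℂ := ∫ x in cell L, f x with hI
  set a : ℂ := (L ^ 3)⁻¹ • I with ha
  set r : ℝ := ‖a‖ with hr
  have hr0 : 0 ≤ r := norm_nonneg a
  set M : ℝ := ∫ x in cell L, ‖f x‖ ^ 2 with hMdef
  set D : ℝ := ∫ x in cell L, ‖f x - a‖ ^ 2 with hDdef
  have hM0 : 0 ≤ M := integral_nonneg fun _ => by positivity
  have hD0 : 0 ≤ D := integral_nonneg fun _ => by positivity
  have hMl : ∫⁻ y in cell L, (‖f y‖₊ : ℝ≥0∞) ^ 2 = ENNReal.ofReal M := by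
    simp only [coe_nnnorm_sq_eq_ofReal]
    exact (ofReal_integral_eq_lintegral_ofReal (integrableOn_sq_cell L hcontf)
      (ae_of_all _ fun _ => by positivity)).symm
  have hg : Measurable fun y => (‖f y - a‖₊ : ℝ≥0∞) ^ 2 :=
    (hcontf.sub continuous_const).measurable.nnnorm.coe_nnreal_ennreal.pow_const 2
  have hDl : ∫⁻ y in cell L, (‖f y - a‖₊ : ℝ≥0∞) ^ 2 = ENNReal.ofReal D := by
    simp only [coe_nnnorm_sq_eq_ofReal]
    exact (ofReal_integral_eq_lintegral_ofReal
      (integrableOn_sq_cell L (hcontf.sub continuous_const))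
      (ae_of_all _ fun _ => by positivity)).symm
  have hR : (ENNReal.ofReal L ^ 3)⁻¹ * (‖I‖₊ : ℝ≥0∞) ^ 2 = ENNReal.ofReal (L ^ 3 * r ^ 2) := by
    rw [Literature.Barriers.AtomisticToContinuum.BoseGas.inv_ofReal_pow_three hL,
      coe_nnnorm_sq_eq_ofReal, ← ENNReal.ofReal_mul (inv_nonneg.2 hL3.le)]
    congr 1
    rw [hr, ha, norm_smul, norm_inv, Real.norm_of_nonneg hL3.le]
    field_simp
  rw [hMl] at hk hP hm0
  rw [hMl, hDl, hR, ← ENNReal.ofReal_add hD0 (by positivity)] at hpy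
  rw [hR] at hP
  -- real consequences: Pythagoras `M = D + L³ r²`, Poincaré `K M ≤ c K M + K L³ r²`
  have hpyth : M = D + L ^ 3 * r ^ 2 := (ENNReal.ofReal_eq_ofReal_iff hM0 (by positivity)).1 hpy
  have hMpos : 0 < M := not_le.1 fun h => hm0 (ENNReal.ofReal_eq_zero.2 h)
  have hKM : K * M ≤ c * K * M + K * (L ^ 3 * r ^ 2) := by
    have h2 : ENNReal.ofReal K * ENNReal.ofReal M ≤
        ENNReal.ofReal (c * K) * ENNReal.ofReal M +
          ENNReal.ofReal K * ENNReal.ofReal (L ^ 3 * r ^ 2) :=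
      hP.trans (by gcongr)
    rw [← ENNReal.ofReal_mul hK0.le, ← ENNReal.ofReal_mul (mul_pos hc0 hK0).le,
      ← ENNReal.ofReal_mul hK0.le,
      ← ENNReal.ofReal_add (mul_nonneg (mul_pos hc0 hK0).le hM0)
        (mul_nonneg hK0.le (mul_nonneg hL3.le (sq_nonneg r))),
      ENNReal.ofReal_le_ofReal_iff (add_nonneg (mul_nonneg (mul_pos hc0 hK0).le hM0)
        (mul_nonneg hK0.le (mul_nonneg hL3.le (sq_nonneg r))))] at h2
    linarith
  have hM1 : M ≤ c * M + L ^ 3 * r ^ 2 :=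
    le_of_mul_le_mul_left (by linarith [hKM] : K * M ≤ K * (c * M + L ^ 3 * r ^ 2)) hK0
  have hD : D ≤ c * M := by
    have e : K * M = K * D + K * (L ^ 3 * r ^ 2) := by rw [hpyth]; ring
    exact le_of_mul_le_mul_left (by linarith [hKM, e] : K * D ≤ K * (c * M)) hK0
  have hM2 : M ≤ 2 * L ^ 3 * r ^ 2 := by nlinarith [hM1, hc2, hM0]
  have hrpos : 0 < r := by
    rcases hr0.lt_or_eq with h | h
    · exact h
    · exfalso
      rw [← h] at hM2
      norm_num at hM2
      linarith
  have hDr : D ≤ 2 * c * L ^ 3 * r ^ 2 := by nlinarith [hD, hM2, hc0]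
  -- the Chebyshev set
  set B : Set Space := {y | r / 2 < ‖f y - a‖} ∩ cell L with hB
  have hBm : MeasurableSet B :=
    (measurableSet_lt measurable_const (hcontf.sub continuous_const).norm.measurable).inter
      (measurableSet_cell L)
  have hBcell : B ⊆ cell L := Set.inter_subset_right
  have hvolB : volume B ≤ ENNReal.ofReal (8 * c * L ^ 3) := by
    have hmk := meas_ge_le_lintegral_div (μ := volume.restrict (cell L)) hg.aemeasurable
      (ε := ENNReal.ofReal ((r / 2) ^ 2)) (ENNReal.ofReal_pos.2 (by positivity)).ne'
      ENNReal.ofReal_ne_top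
    rw [Measure.restrict_apply' (measurableSet_cell L), hDl,
      ← ENNReal.ofReal_div_of_pos (by positivity)] at hmk
    have hsub : B ⊆ {y | ENNReal.ofReal ((r / 2) ^ 2) ≤ (‖f y - a‖₊ : ℝ≥0∞) ^ 2} ∩ cell L := by
      intro y hy
      refine ⟨?_, hy.2⟩
      rw [Set.mem_setOf_eq, coe_nnnorm_sq_eq_ofReal]
      exact ENNReal.ofReal_le_ofReal (pow_le_pow_left₀ (by positivity) (le_of_lt hy.1) 2)
    refine ((measure_mono hsub).trans hmk).trans (ENNReal.ofReal_le_ofReal ?_)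
    rw [div_le_iff₀ (by positivity)]
    nlinarith [hDr]
  have hintB : ∫⁻ y in B, (‖f y‖₊ : ℝ≥0∞) ^ 2 ≤ ENNReal.ofReal (ε * r ^ 2 * L ^ 3) := by
    have hpt : ∀ y, (‖f y‖₊ : ℝ≥0∞) ^ 2 ≤
        2 * (‖f y - a‖₊ : ℝ≥0∞) ^ 2 + ENNReal.ofReal (2 * r ^ 2) := by
      intro y
      have h1 : ‖f y‖ ^ 2 ≤ 2 * ‖f y - a‖ ^ 2 + 2 * r ^ 2 := by
        have h := pow_le_pow_left₀ (norm_nonneg _) (norm_le_norm_add_norm_sub' (f y) a) 2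
        rw [← hr] at h
        nlinarith [sq_nonneg (r - ‖f y - a‖)]
      calc ((‖f y‖₊ : ℝ≥0∞)) ^ 2 = ENNReal.ofReal (‖f y‖ ^ 2) := coe_nnnorm_sq_eq_ofReal _
        _ ≤ ENNReal.ofReal (2 * ‖f y - a‖ ^ 2 + 2 * r ^ 2) := ENNReal.ofReal_le_ofReal h1
        _ = 2 * (‖f y - a‖₊ : ℝ≥0∞) ^ 2 + ENNReal.ofReal (2 * r ^ 2) := by
            rw [ENNReal.ofReal_add (by positivity) (by positivity),
              ENNReal.ofReal_mul (p := 2) (q := ‖f y - a‖ ^ 2) zero_le_two, ENNReal.ofReal_ofNat,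
              coe_nnnorm_sq_eq_ofReal]
    calc ∫⁻ y in B, (‖f y‖₊ : ℝ≥0∞) ^ 2
        ≤ ∫⁻ y in B, (2 * (‖f y - a‖₊ : ℝ≥0∞) ^ 2 + ENNReal.ofReal (2 * r ^ 2)) :=
          lintegral_mono fun y => hpt y
      _ = 2 * (∫⁻ y in B, (‖f y - a‖₊ : ℝ≥0∞) ^ 2) + ENNReal.ofReal (2 * r ^ 2) * volume B := by
          rw [lintegral_add_right _ measurable_const, lintegral_const_mul _ hg, setLIntegral_const]
      _ ≤ 2 * (∫⁻ y in cell L, (‖f y - a‖₊ : ℝ≥0∞) ^ 2) +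
            ENNReal.ofReal (2 * r ^ 2) * ENNReal.ofReal (8 * c * L ^ 3) :=
          add_le_add (mul_le_mul_right (lintegral_mono_set hBcell) _) (mul_le_mul_right hvolB _)
      _ = ENNReal.ofReal (2 * D + 2 * r ^ 2 * (8 * c * L ^ 3)) := by
          rw [hDl, ENNReal.ofReal_add (by positivity) (by positivity),
            ENNReal.ofReal_mul (p := 2) (q := D) zero_le_two, ENNReal.ofReal_ofNat,
            ENNReal.ofReal_mul (p := 2 * r ^ 2) (by positivity)]
      _ ≤ ENNReal.ofReal (ε * r ^ 2 * L ^ 3) :=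
          ENNReal.ofReal_le_ofReal (by nlinarith [hDr, hcε, mul_nonneg hL3.le (sq_nonneg r)])
  refine ⟨r, hrpos, B, hBm, hvolB.trans (ENNReal.ofReal_le_ofReal (by nlinarith [hcε, hL3, hε])),
    hintB, fun y hy => ?_⟩
  have hya : ‖f y - a‖ ≤ r / 2 := not_lt.1 fun h => hy.2 ⟨h, hy.1⟩
  have h1 := norm_sub_norm_le a (f y)
  have h2 := norm_le_norm_add_norm_sub' (f y) a
  rw [norm_sub_rev] at h1
  rw [← hr] at h1 h2
  constructor <;> linarith

end Helpers

/-- **Registered stub `stub_freeTorusSlices`** (S3 of line `Sketch`, crux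
stmt-AtomisticToContinuum-0827, free class `v = 0`): for every `n`, `L > 0`, `ε, η > 0` there is
`δ > 0` such that every periodic state `Φ` of `n + 1` bosons on the torus of side `L` with
`periodicEnergy 0 Φ ≤ δ` admits a measurable event `E` of baths of `P`-probability `≥ 1 - η`,
`P = |Φ|² 1_{cell^{n+1}} dW`, on which the slice `y ↦ Φ(y, tail W)` is nearly constant in
modulus: `μ/2 ≤ |Φ(y, tail W)| ≤ 3μ/2` off a set `B` of volume `≤ ε L³` and slice mass `≤ ε μ² L³`.
Markov in the bath, the cell Poincaré inequality and Chebyshev on the slice. [folklore] -/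
theorem stub_freeTorusSlices :
    ∀ (n : ℕ) (L : ℝ), 0 < L → ∀ ε : ℝ, 0 < ε → ∀ η : ℝ, 0 < η →
      ∃ δ : ℝ≥0∞, 0 < δ ∧ ∀ Φ : PeriodicTrialState (n + 1) L, periodicEnergy 0 Φ ≤ δ →
        ∃ E : Set (Config (n + 1)), MeasurableSet E ∧
          ((volume.restrict (cellN (n + 1) L)).withDensity (fun W => (‖Φ.ψ W‖₊ : ℝ≥0∞) ^ 2)) Eᶜ ≤
            ENNReal.ofReal η ∧
          ∀ W ∈ E, ∃ μ : ℝ, 0 < μ ∧ ∃ B : Set Space, MeasurableSet B ∧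
            volume B ≤ ENNReal.ofReal (ε * L ^ 3) ∧
            ∫⁻ y in B, ENNReal.ofReal ‖Φ.ψ (Matrix.vecCons y (Matrix.vecTail W))‖ ^ 2 ≤
              ENNReal.ofReal (ε * μ ^ 2 * L ^ 3) ∧
            ∀ y ∈ cell L \ B, μ / 2 ≤ ‖Φ.ψ (Matrix.vecCons y (Matrix.vecTail W))‖ ∧
              ‖Φ.ψ (Matrix.vecCons y (Matrix.vecTail W))‖ ≤ 3 * μ / 2 := by
  intro n L hL ε hε η hη
  have ht0 : 0 < min (1 / 2) (ε / 20) * (Real.pi / L) ^ 2 := by positivity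
  set t : ℝ := min (1 / 2) (ε / 20) * (Real.pi / L) ^ 2 with ht
  refine ⟨ENNReal.ofReal t * ENNReal.ofReal η,
    ENNReal.mul_pos (ENNReal.ofReal_pos.2 ht0).ne' (ENNReal.ofReal_pos.2 hη).ne', fun Φ hΦ => ?_⟩
  simp only [ofReal_norm, enorm_eq_nnnorm]
  have hcont : Continuous Φ.ψ := Φ.contDiff.continuous
  have hdiff : Differentiable ℝ Φ.ψ := Φ.contDiff.differentiable one_ne_zero
  -- the law's density, the slice mass `m` and the slice kinetic energy `k` of a bath
  set ρ : Config (n + 1) → ℝ≥0∞ := fun W => (‖Φ.ψ W‖₊ : ℝ≥0∞) ^ 2 with hρ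
  have hρm : Measurable ρ := measurable_normSq hcont
  set m : Config n → ℝ≥0∞ := fun V => ∫⁻ y in cell L, ρ (Matrix.vecCons y V) with hm
  set k : Config n → ℝ≥0∞ :=
    fun V => ∫⁻ y in cell L, partialGradSq 0 Φ.ψ (Matrix.vecCons y V) with hk
  have hmm : Measurable m := measurable_setLIntegral_vecCons_slice hρm _
  have hkm : Measurable k :=
    measurable_setLIntegral_vecCons_slice (measurable_partialGradSq 0 Φ.ψ) _
  -- good baths: `k ≤ t m`, `m ≠ 0`; the event `E = {tail W good}`
  set G : Set (Config n) := {V | k V ≤ ENNReal.ofReal t * m V} ∩ m ⁻¹' {0}ᶜ with hG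
  have hGm : MeasurableSet G :=
    (measurableSet_le hkm (hmm.const_mul _)).inter (hmm (measurableSet_singleton 0).compl)
  set E : Set (Config (n + 1)) := {W | Matrix.vecTail W ∈ G} with hE
  have hEm : MeasurableSet E := measurable_vecTail hGm
  have hiff : ∀ (x : Space) (V : Config n), Matrix.vecCons x V ∈ E ↔ V ∈ G := fun x V => by
    show Matrix.vecTail (Matrix.vecCons x V) ∈ G ↔ V ∈ G
    rw [Matrix.tail_cons]
  refine ⟨E, hEm, ?_, fun W hW => ?_⟩
  · -- `t · P(Eᶜ) ≤ ∫_{cellⁿ} k ≤ periodicEnergy 0 Φ ≤ t η`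
    rw [withDensity_apply _ hEm.compl, ← lintegral_indicator hEm.compl,
      setLIntegral_cellN_succ (hρm.indicator hEm.compl)]
    have h1 : ∀ V, ∫⁻ x in cell L, Eᶜ.indicator ρ (Matrix.vecCons x V) = Gᶜ.indicator m V := by
      intro V
      by_cases hV : V ∈ G
      · rw [Set.indicator_of_notMem (Set.notMem_compl_iff.2 hV)]
        refine (lintegral_congr fun x => ?_).trans lintegral_zero
        exact Set.indicator_of_notMem (Set.notMem_compl_iff.2 ((hiff x V).2 hV)) _
      · rw [Set.indicator_of_mem (Set.mem_compl hV)]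
        exact lintegral_congr fun x =>
          Set.indicator_of_mem (Set.mem_compl fun h => hV ((hiff x V).1 h)) _
    have h2 : ∀ V, ENNReal.ofReal t * Gᶜ.indicator m V ≤ k V := by
      intro V
      by_cases hV : V ∈ G
      · rw [Set.indicator_of_notMem (Set.notMem_compl_iff.2 hV), mul_zero]
        exact zero_le
      · rw [Set.indicator_of_mem (Set.mem_compl hV)]
        by_cases hmV : m V = 0
        · rw [hmV, mul_zero]
          exact zero_le
        · exact (not_le.1 fun h => hV ⟨h, hmV⟩).le
    rw [lintegral_congr h1]
    refine (ENNReal.mul_le_mul_iff_right (ENNReal.ofReal_pos.2 ht0).ne' ENNReal.ofReal_ne_top).1 ?_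
    calc ENNReal.ofReal t * ∫⁻ V in cellN n L, Gᶜ.indicator m V
        = ∫⁻ V in cellN n L, ENNReal.ofReal t * Gᶜ.indicator m V :=
          (lintegral_const_mul' _ _ ENNReal.ofReal_ne_top).symm
      _ ≤ ∫⁻ V in cellN n L, k V := lintegral_mono h2
      _ = ∫⁻ X in cellN (n + 1) L, partialGradSq 0 Φ.ψ X :=
          (setLIntegral_cellN_succ (measurable_partialGradSq 0 Φ.ψ)).symm
      _ ≤ ∫⁻ X in cellN (n + 1) L,
            (kineticDensity Φ.ψ X + periodicInteraction 0 L X * (‖Φ.ψ X‖₊ : ℝ≥0∞) ^ 2) :=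
          lintegral_mono fun X => partialGradSq_zero_le Φ.ψ _ X
      _ = periodicEnergy 0 Φ := rfl
      _ ≤ ENNReal.ofReal t * ENNReal.ofReal η := hΦ
  · -- a good bath: Poincaré + Chebyshev on the slice
    have hW' : Matrix.vecTail W ∈ G := hW
    have hkW : k (Matrix.vecTail W) ≤ ENNReal.ofReal t * m (Matrix.vecTail W) := hW'.1
    have hmW : m (Matrix.vecTail W) ≠ 0 := hW'.2
    have hkV : ∫⁻ y in cell L, gradSqC (fun z => Φ.ψ (Matrix.vecCons z (Matrix.vecTail W))) y ≤
        ENNReal.ofReal t *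
          ∫⁻ y in cell L, (‖Φ.ψ (Matrix.vecCons y (Matrix.vecTail W))‖₊ : ℝ≥0∞) ^ 2 := by
      simp only [gradSqC_vecCons_eq_partialGradSq hdiff]
      exact hkW
    exact slice_typical (f := fun z => Φ.ψ (Matrix.vecCons z (Matrix.vecTail W))) hL hε
      (contDiff_vecCons_slice Φ.contDiff _) hmW hkV

end Summit.AtomisticToContinuum.BoseEinsteinCondensation.CoupledBaths

end
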